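import Literature.NumberTheory.Automorphic.Liu2021.AppendixC.HeckeTranslateLevelQuotient
import Literature.NumberTheory.Automorphic.Liu2021.AppendixC.HeckeTranslateSepQuotient
import Literature.NumberTheory.Automorphic.Liu2021.AppendixC.HeckePushPullPackageInjective
import HarnessLib

/-!
# The translate `q′ = T_{γ⁻¹} : X_{N″} → X_N` as a quotient by a FAITHFUL finite group of translates `T_k`, `k ∈ K`
# (Milne 2005 §5 / §13; Mumford §7) — the (S2) «translate package» of the d6 `stub_RosH` glue

Topic `NumberTheory/Automorphic/Liu2021/AppendixC`; namespace `Literature.NumberTheory.Automorphic.Liu2021.AppendixC.Sec42Data.HeckeTranslates`.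
PROOF FILE (theorems only; no definition, no named fact, no instance, no `sorry`).  Sequel of ★ `HeckeTranslateLevelQuotient`
(`exists_finite_isSepQuotient_map'`, `exists_finite_isSepQuotient_translate`), ★ `HeckeTranslateSepQuotient` (`exists_isSepQuotient_tr`,
the level isomorphism `T_{γ⁻¹} : X_{N″} ⥲ X_{γN″γ⁻¹}`) and ★ `HeckePushPullPackageInjective` (`isSepQuotient_kerLift`).

THE SITUATION ([Milne2005ShimuraVarieties] §5 p. 57 L7–12, p. 58 L3–11: the right action `T(g)`, `T_1 = u`, `T_g ≫ T_{g′} = T_{gg′}`,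
`T_k = 𝟙` on `X_K` for `k ∈ K`, and `Sh_K = Sh_{K′}/(K/K′)` for `K′ ⊴ K`; §13 p. 118 L21–26).  Levels `N″ ≤ K` with `N″` NORMAL in `K`
(`hn″`), `N ≤ K`, and `γ` with `γ⁻¹Nγ ⊆ K` (`HeckeLE γ N K`) and `γN″γ⁻¹ ⊆ N` (`HeckeLE γ⁻¹ N″ N`).  ★ `exists_finite_isSepQuotient_translate`
says that `q′ := T_{γ⁻¹} : X_{N″} → X_N` is a quotient of `X_{N″}` by SOME finite group action and `q′ ≫ T_γ = u : X_{N″} → X_K`.  This file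
re-issues that package with the two letters the (G4Σ) consumer needs ((S2) of A-p18 (g12) / the (L) pen A-p02 (g14), cell
`hodgecm-mathlib`, 2026-08-30):

* the action CONSISTS OF TRANSLATES `T_k : X_{N″} → X_{N″}` with `k ∈ K` — indeed the quotient `X_{γN″γ⁻¹} → X_N` is by translates
  `T_m`, `m ∈ N` (★ `exists_finite_isSepQuotient_map'`), and conjugating `T_m` along the level isomorphism `T_{γ⁻¹}` gives
  `T_{γ⁻¹} ≫ T_m ≫ T_γ = T_{γ⁻¹mγ}` (`tr_mul`) with `γ⁻¹mγ ∈ K` (`HeckeLE γ N K`) — §1;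
* the action is FAITHFUL (`Function.Injective act`) — pass to `Δ ∕ ker act` (★ `isSepQuotient_kerLift`; [MumfordAV1970] §7 Remark: the
  universal property of a quotient only sees the set `{act δ}`) — §2;

and §3 the complexified form (★ `isSepQuotient_baseChangeHom_of_isProjectiveOver`, [SGA1] V §1), the `act`∕`hp` input of
★ `exists_subgroup_isSepQuotient_pieceMap'` at the complex pieces.  With ★ `eq_one_of_translate_rigid` and the translate rigidity of the
tower (★ `RecordSystemGS.heckeTranslate_eq_id_of_comp_eq`) the letters make the piece stabilisers of the `q′`-deck group act faithfully
(`hrig` of ★ `Motives.card_pieceGroup_eq_card_stabilizer`).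

Cell `hodgecm-mathlib` (D-0151), crux `HLiu418` = stmt-HodgeConjecture-24832, d6 line, `stub_RosH` glue (G4Σ)/(C).  COUNT-NEUTRAL capital:
HC_CM is proved only modulo the 7 printed citations until rung 0 closes; nothing here discharges a binder.

## References
* [Milne2005ShimuraVarieties] J. S. Milne, *Introduction to Shimura varieties* (2005), §5 p. 57 L7–12, p. 58 L3–11, Rem. 5.29 (c) p. 65;
  §13 p. 118 L21–26.
* [MumfordAV1970] D. Mumford, *Abelian Varieties* (1970), §7 Thm. p. 66 and Remark.
* [Deligne1979ShimuraVarieties] P. Deligne, *Variétés de Shimura*, Proc. Symp. Pure Math. 33 (1979), 2.7.1 (b)–(c), 2.1.2.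
* [SGA1] A. Grothendieck, *Revêtements étales et groupe fondamental* (SGA 1), Exp. V §1 Prop. 1.1, 1.8.
* [Liu2021] Y. Liu, *Fourier–Jacobi cycles and arithmetic relative trace formula*, Camb. J. Math. 9 (2021), §4.2 (FJcycle.tex l. 2062–2074).
-/

set_option autoImplicit false

noncomputable section

open CategoryTheory AlgebraicGeometry NumberField
open Literature.AlgebraicGeometry.Motives

namespace Literature.NumberTheory.Automorphic.Liu2021.AppendixC

universe v

section Sec42

variable {F E : Type} [Field F] [NumberField F] [IsTotallyReal F] [Field E] [NumberField E] [Algebra F E]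
  [IsTotallyComplex E] [Algebra.IsQuadraticExtension F E]
variable {P5 : PropC5Data F E} {isotropicAt : ℕ → Prop}

namespace Sec42Data.HeckeTranslates

variable {C : Sec42Data P5 isotropicAt} (T : C.HeckeTranslates)

/-! ## §1 Conjugating an action by translates `T_m` (`m ∈ N`) along `T_{γ⁻¹} : X_{N″} ⥲ X_{γN″γ⁻¹}` gives translates `T_{γ⁻¹mγ}` -/

/-- **The conjugated quotient action consists of translates.**  If the level projection `X_{γN″γ⁻¹} → X_N` (`heckeLevel γ N″ ≤ N`) is a
quotient of `X_{γN″γ⁻¹}` by `act₃ : Δ →* Aut`, every `act₃ δ` being a translate `T_m` with `m ∈ N`, then `T_{γ⁻¹} : X_{N″} → X_N` is a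
quotient of `X_{N″}` by an action of the SAME group `Δ` every element of which is a translate `T_k : X_{N″} → X_{N″}` with `k ∈ K` —
namely `T_{γ⁻¹} ≫ T_m ≫ T_γ = T_{γ⁻¹mγ}` ([Milne2005ShimuraVarieties] §5 p. 58 L6–11 `T_g ≫ T_{g′} = T_{gg′}`), `γ⁻¹mγ ∈ K` because
`γ⁻¹Nγ ⊆ K`.  (The quotient half is ★ `exists_isSepQuotient_tr`; here the action is kept explicit.)
[cite: Milne2005ShimuraVarieties, §5 p. 57 L7–12, p. 58 L3–11 and §13 p. 118 L21–26] [cite: MumfordAV1970, §7 Thm. p. 66 (Remark)] -/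
theorem exists_act_tr_of_translates (γ : C.G) {N'' N K : C5.SmallLevel C.S.K₀} (hn'' : ∀ k ∈ K.1.1, C5.HeckeLE k N'' N'')
    (hγ : C5.HeckeLE γ N K) (h : C5.HeckeLE γ⁻¹ N'' N)
    (hn₃ : ∀ m ∈ N.1.1, C5.HeckeLE m (C5.heckeLevel γ N'') (C5.heckeLevel γ N''))
    {Δ : Type v} [Group Δ] (act₃ : Δ →* Aut (C.X (C5.heckeLevel γ N'')))
    (hact₃ : ∀ δ, ∃ (m : C.G) (hm : m ∈ N.1.1), (act₃ δ).hom = T.tr m (C5.heckeLevel γ N'') (C5.heckeLevel γ N'') (hn₃ m hm))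
    (hq : IsSepQuotient (fun δ => act₃ δ) (C.cpt.X.map (homOfLE (C5.heckeLevel_le_of_heckeLE_inv h)))) :
    ∃ act : Δ →* Aut (C.X N''),
      (∀ δ, ∃ (k : C.G) (hk : k ∈ K.1.1), (act δ).hom = T.tr k N'' N'' (hn'' k hk)) ∧
      (∀ δ, act δ = 1 → act₃ δ = 1) ∧
      IsSepQuotient (fun δ => act δ) (T.tr γ⁻¹ N'' N h) := by
  have h₁ : C5.HeckeLE γ⁻¹ N'' (C5.heckeLevel γ N'') := C5.heckeLE_inv_heckeLevel h
  have h₂ : C5.HeckeLE γ (C5.heckeLevel γ N'') N'' := C5.heckeLE_heckeLevel γ N''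
  let e : C.X N'' ≅ C.X (C5.heckeLevel γ N'') :=
    ⟨T.tr γ⁻¹ N'' _ h₁, T.tr γ _ N'' h₂, T.tr_inv_comp_tr_eq_id γ h₁ h₂, T.tr_comp_tr_inv_eq_id γ h₁ h₂⟩
  refine ⟨e.symm.conjAut.toMonoidHom.comp act₃, fun δ => ?_, fun δ hδ => ?_, ?_⟩
  · -- `(act δ).hom = T_{γ⁻¹} ≫ T_m ≫ T_γ = T_{γ⁻¹ m γ}`
    obtain ⟨m, hm, hmδ⟩ := hact₃ δ
    refine ⟨γ⁻¹ * m * γ, hγ m hm, ?_⟩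
    change (e.symm.conjAut (act₃ δ)).hom = _
    rw [Iso.conjAut_hom, Iso.conj_apply, Iso.symm_inv, Iso.symm_hom, hmδ]
    change T.tr γ⁻¹ N'' _ h₁ ≫ T.tr m _ _ (hn₃ m hm) ≫ T.tr γ _ N'' h₂ = _
    rw [T.tr_mul, T.tr_mul]
    exact T.tr_congr (mul_assoc _ _ _).symm _ _
  · -- `act δ = 1 ⇒ act₃ δ = 1` (conjugation is a group isomorphism)
    have h1 : e.symm.conjAut (act₃ δ) = 1 := hδ
    exact (MulEquiv.map_eq_one_iff _).1 h1
  · -- the quotient property along the level isomorphism (as ★ `exists_isSepQuotient_tr`)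
    have htr : T.tr γ⁻¹ N'' N h = e.hom ≫ C.cpt.X.map (homOfLE (C5.heckeLevel_le_of_heckeLE_inv h)) := by
      change _ = T.tr γ⁻¹ N'' _ h₁ ≫ _
      rw [T.tr_comp_map]
    rw [htr]
    exact isSepQuotient_iso_hom_comp e act₃ hq

/-! ## §2 The (S2) translate package: finite, faithful, by translates `T_k` (`k ∈ K`), dominating `T_γ` -/

/-- **THE TRANSLATE PACKAGE OF `q′ = T_{γ⁻¹} : X_{N″} → X_N` WITH AN INJECTIVE ACTION BY TRANSLATES.**  For `N″ ⊴ K` (`hn″`),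
`N″ ≤ K`, `γ⁻¹Nγ ⊆ K` (`hγ`), `γN″γ⁻¹ ⊆ N` (`h`), granted the level-quotient universal property at all normal level pairs (`hUP`):
there is a FINITE NON-EMPTY group `Δ` with an INJECTIVE action `act : Δ →* Aut X_{N″}` every element of which is a translate `T_k`,
`k ∈ K`, such that `T_{γ⁻¹} : X_{N″} → X_N` is a quotient of `X_{N″}` by `act` for separated test objects, and `T_{γ⁻¹} ≫ T_γ = u :
X_{N″} → X_K` — ★ `exists_finite_isSepQuotient_translate` with the two letters «by translates» (§1 over ★ `exists_finite_isSepQuotient_map'`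
at the conjugate level `γN″γ⁻¹ ≤ N`, normal in `N` by ★ `C5.conj_mem_heckeLevel_of_normal`) and «faithful» (the quotient `Δ ∕ ker act`,
★ `isSepQuotient_kerLift`; [MumfordAV1970] §7 Remark).  `τ` is unused data kept for letter-alignment with ★ `exists_levelPackage_inj` ∕
★ `exists_pushPull_package_inj`. [cite: Milne2005ShimuraVarieties, §5 p. 57 L7–12, p. 58 L3–11 and Rem. 5.29 (c) p. 65; §13 p. 118 L21–26]
[cite: MumfordAV1970, §7 Thm. p. 66 (Remark)] [cite: Deligne1979ShimuraVarieties, 2.7.1 (b)–(c)] -/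
theorem exists_translatePackage_inj (_τ : E →+* ℂ)
    (hUP : ∀ ⦃N₁ K₁ : C5.SmallLevel C.S.K₀⦄ (h₁ : N₁ ≤ K₁) (hn₁ : ∀ k ∈ K₁.1.1, C5.HeckeLE k N₁ N₁)
      (W : SchemeOver E) (f : C.X N₁ ⟶ W), IsSeparated W.hom →
      (∀ (k : C.G) (hk : k ∈ K₁.1.1), T.tr k N₁ N₁ (hn₁ k hk) ≫ f = f) → ∃! fbar : C.X K₁ ⟶ W, C.cpt.X.map (homOfLE h₁) ≫ fbar = f)
    (γ : C.G) ⦃N'' N K : C5.SmallLevel C.S.K₀⦄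
    (hn'' : ∀ k ∈ K.1.1, C5.HeckeLE k N'' N'') (hle : N'' ≤ K) (hγ : C5.HeckeLE γ N K) (h : C5.HeckeLE γ⁻¹ N'' N) :
    ∃ (Δ : Type) (_ : Group Δ) (_ : Fintype Δ) (_ : Nonempty Δ) (act : Δ →* Aut (C.X N''))
      (_ : Function.Injective act)
      (_ : ∀ δ, ∃ (k : C.G) (hk : k ∈ K.1.1), (act δ).hom = T.tr k N'' N'' (hn'' k hk)),
      IsSepQuotient (fun δ => act δ) (T.tr γ⁻¹ N'' N h) ∧
        T.tr γ⁻¹ N'' N h ≫ T.tr γ N K hγ = C.cpt.X.map (homOfLE hle) := by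
  classical
  have hle₃ : C5.heckeLevel γ N'' ≤ N := C5.heckeLevel_le_of_heckeLE_inv h
  have hn₃ : ∀ m ∈ N.1.1, C5.HeckeLE m (C5.heckeLevel γ N'') (C5.heckeLevel γ N'') :=
    C5.conj_mem_heckeLevel_of_normal hn'' hγ hle₃
  obtain ⟨Δ, instG, instF, act₃, hact₃, -, hq₃⟩ := T.exists_finite_isSepQuotient_map' hle₃ hn₃ (hUP hle₃ hn₃)
  obtain ⟨act, hact, -, hq⟩ := T.exists_act_tr_of_translates γ hn'' hγ h hn₃ act₃ hact₃ hq₃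
  -- the faithful quotient `Δ ∕ ker act`
  have hq' : IsSepQuotient (fun g => QuotientGroup.kerLift act g) (T.tr γ⁻¹ N'' N h) := isSepQuotient_kerLift act hq
  letI : Fintype (Δ ⧸ act.ker) := Fintype.ofFinite _
  refine ⟨Δ ⧸ act.ker, inferInstance, inferInstance, ⟨1⟩, QuotientGroup.kerLift act, QuotientGroup.kerLift_injective act,
    fun δ => ?_, hq', T.tr_inv_comp_tr_eq_map γ h hγ hle⟩
  obtain ⟨d, rfl⟩ := QuotientGroup.mk_surjective δ
  rw [QuotientGroup.kerLift_mk]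
  exact hact d

/-! ## §3 After base change to `ℂ` -/

/-- **The complexified translate package**: `exists_translatePackage_inj` together with — for any `τ : E →+* ℂ` — the separatedness of
`(X_N)_τ`, the base-changed quotient property of `(T_{γ⁻¹})_τ` for the SAME injective action (★ `isSepQuotient_baseChangeHom_of_isProjectiveOver`,
`X_{N″}` projective), and the base-changed domination `(T_{γ⁻¹})_τ ≫ (T_γ)_τ = (u)_τ` — the `act`∕`hp` input of ★
`exists_subgroup_isSepQuotient_pieceMap'` ∕ ★ `exists_subgroup_isSepQuotient_pieceMap_card` at the complex pieces of `X_{N″}`.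
[cite: SGA1, Exp. V §1 Prop. 1.1, 1.8] [cite: Milne2005ShimuraVarieties, §13 p. 118 L21–26 and Rem. 5.29 (c) p. 65] [cite: MumfordAV1970, §7 Thm. p. 66 (Remark)] -/
theorem exists_translatePackage_inj_baseChange (τ : E →+* ℂ)
    (hUP : ∀ ⦃N₁ K₁ : C5.SmallLevel C.S.K₀⦄ (h₁ : N₁ ≤ K₁) (hn₁ : ∀ k ∈ K₁.1.1, C5.HeckeLE k N₁ N₁)
      (W : SchemeOver E) (f : C.X N₁ ⟶ W), IsSeparated W.hom →
      (∀ (k : C.G) (hk : k ∈ K₁.1.1), T.tr k N₁ N₁ (hn₁ k hk) ≫ f = f) → ∃! fbar : C.X K₁ ⟶ W, C.cpt.X.map (homOfLE h₁) ≫ fbar = f)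
    (γ : C.G) ⦃N'' N K : C5.SmallLevel C.S.K₀⦄
    (hn'' : ∀ k ∈ K.1.1, C5.HeckeLE k N'' N'') (hle : N'' ≤ K) (hγ : C5.HeckeLE γ N K) (h : C5.HeckeLE γ⁻¹ N'' N) :
    ∃ (Δ : Type) (_ : Group Δ) (_ : Fintype Δ) (_ : Nonempty Δ) (act : Δ →* Aut (C.X N''))
      (_ : Function.Injective act)
      (_ : ∀ δ, ∃ (k : C.G) (hk : k ∈ K.1.1), (act δ).hom = T.tr k N'' N'' (hn'' k hk)),
      IsSepQuotient (fun δ => act δ) (T.tr γ⁻¹ N'' N h) ∧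
        T.tr γ⁻¹ N'' N h ≫ T.tr γ N K hγ = C.cpt.X.map (homOfLE hle) ∧
        IsSeparated ((baseChangeHom τ).obj (C.X N)).hom ∧
        IsSepQuotient (fun δ => (baseChangeHom τ).mapIso (act δ)) ((baseChangeHom τ).map (T.tr γ⁻¹ N'' N h)) ∧
        (baseChangeHom τ).map (T.tr γ⁻¹ N'' N h) ≫ (baseChangeHom τ).map (T.tr γ N K hγ) =
          (baseChangeHom τ).map (C.cpt.X.map (homOfLE hle)) := by
  obtain ⟨Δ, instG, instF, instN, act, hinj, hact, hq, hcomp⟩ := T.exists_translatePackage_inj τ hUP γ hn'' hle hγ h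
  obtain ⟨hsep, hqℂ⟩ := isSepQuotient_baseChangeHom_of_isProjectiveOver E τ Δ (C.X N'') (C.X N) (C.cpt.projective_X N'') act
    (T.tr γ⁻¹ N'' N h) (C.cpt.projective_X N).isSeparated hq
  have hcomp' : (baseChangeHom τ).map (T.tr γ⁻¹ N'' N h) ≫ (baseChangeHom τ).map (T.tr γ N K hγ) =
      (baseChangeHom τ).map (C.cpt.X.map (homOfLE hle)) := by
    rw [← Functor.map_comp, hcomp]
  exact ⟨Δ, instG, instF, instN, act, hinj, hact, hq, hcomp, hsep, hqℂ, hcomp'⟩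

end Sec42Data.HeckeTranslates

end Sec42

end Literature.NumberTheory.Automorphic.Liu2021.AppendixC

end
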